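import Summits.CriticalPhenomena.PercolationContinuityZ3.Theorems.Transplant.FKDoubleFanSameApex
import HarnessLib

/-!
# Double fans `K₂ ∨ P_{m+1}`: conditionally on `a ↮ b`, an `a`-spoke and a `b`-spoke at ANY distance are negatively correlated
# (the `a ≁ b` SECTOR of the transfer, a three-dimensional invariant-cone argument valid for all `0 ≤ q ≤ 1`)

Helper file (`--supports stmt-CriticalPhenomena-4575`), FK sub-lane `prim-bschramm-fk-3` (gen 26); builds on p205010 (kernel theorem, internal
audit signed; external expert review pending).  Pure real algebra: no measures, no named facts, no sorries; standard axioms.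
Memo `bschramm/prim-bschramm-fk-3/FAR-CROSS.md` §2–§3.

STRUCTURE.  In the transfer over the partition lattice `Π₃` of the moving boundary `{a, b, c}` (`…ThreeApexAlgebra`, `…ThreeApexRimStep`)
the three partitions with `a ≁ b` — `a|b|c`, `ac|b`, `bc|a` — span a SECTOR that every letter and every rim step maps to itself
(connectivity only grows): the masses `(Z_0, Z_ac, Z_bc)` of a product / rim step depend only on those of the input (`sec_conv`,
`sec_rimStep`), through the non-negative `3 × 3` maps `secConv z`, `secRim q r`.  Gluing two gadgets along the boundary and keeping only the
configurations with `a ≁ b` is the bilinear form `secG` (`valSep_conv`; `valSep q Z = q³Z_0 + q²(Z_ac + Z_bc)` is `val` restricted to `a ≁ b`).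
Hence for the cross-apex pair `(a c_j, b c_k)`, `j < k` at ANY distance, the four pinned partition functions RESTRICTED TO `{a ↮ b}` are
`C^{στ} = valSep_q((BC^τ s) ∗ E_{r_d} ∗ [AC(x)BC(y)E_r]⋯ ∗ (AC^σ u))` (`crossSecZ`), and their Rayleigh difference is a pairing of CROSS
PRODUCTS: `C¹⁰C⁰¹ − C¹¹C⁰⁰ = q⁴·Y·Z''·⟨w(s), cof(word)·v(u)⟩` with `v(u) = (u_bc, 0, −u_0)`, `w(s) = (s_0+s_ac, (1−q)s_0 − s_ac, −(s_0+s_ac))`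
and the COFACTOR maps `cofConv`, `cofRim` (`scross_secConv`, `scross_secRim`: `(FP) × (FQ) = cof(F)(P × Q)`).
THE CONE.  `SecCone p ω :⇔ ω₁ ≥ 0, ω₂ ≤ 0, ω₃ ≤ 0, ω₁ − ω₃ + p ω₂ ≥ 0` (`p = 1 − q`) contains `v(u)`, is mapped to itself by every `cofConv z`
(`z_0, z_ac, z_bc ≥ 0`) and every `cofRim q r` (`q, r ∈ [0,1]`) (**`SecCone.cofConv`**, **`SecCone.cofRim`** — four one-line inequalities each),
and `⟨w(s), ω⟩ = s_ac(ω₁−ω₂−ω₃) + s_0(ω₁−ω₃+pω₂) ≥ 0` on it.  THEOREM **`rayleigh_crossSec_nonneg`** / **`InKE.rayleigh_crossSec_nonneg`**: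
`C¹⁰C⁰¹ ≥ C¹¹C⁰⁰` for every list of middle blocks with weights in `[0,1]`, every last rim weight in `[0,1]`, all rests `u, s` with
non-negative masses, all `0 ≤ q ≤ 2` — i.e. in every weighted double fan (more generally every graph of the double-fan class), CONDITIONALLY
ON THE APICES NOT BEING CONNECTED, any `a`-spoke and any `b`-spoke are negatively correlated.  (The unconditional statement at distance
`k − j ≥ 2` is open; by the memo's block decomposition it is this theorem plus the merged-fan term minus a mixed term.)
[cite: Grimmett2006, §3.9 eq. (3.94) (pp. 63–64)] [folklore]
-/

noncomputable section

namespace Summit.CriticalPhenomena.PercolationContinuityZ3.Theorems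

namespace FK

namespace ThreeApex

/-! ### The `a ≁ b` sector: coordinates, letter and rim-step action, the gluing form -/

/-- A triple of masses on the three partitions `a|b|c`, `ac|b`, `bc|a` with `a ≁ b` (or a dual triple). [folklore] -/
@[ext] structure S3 where
  /-- mass of `a|b|c` (dual: first coordinate) -/
  s0 : ℝ
  /-- mass of `ac|b` -/
  sac : ℝ
  /-- mass of `bc|a` -/
  sbc : ℝ

/-- The sector coordinates of a fibre-mass vector. [folklore] -/
def sec (Z : V5) : S3 := ⟨Z.z0, Z.zac, Z.zbc⟩

/-- The letter `z` acting on the sector (a non-negative lower-triangular map). [folklore] -/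
def secConv (z : V5) (P : S3) : S3 :=
  ⟨z.z0 * P.s0, z.zac * P.s0 + (z.z0 + z.zac) * P.sac, z.zbc * P.s0 + (z.z0 + z.zbc) * P.sbc⟩

/-- The rim step acting on the sector: `(P_0, P_ac, P_bc) ↦ (rP_0 + (1−r)(qP_0 + P_ac + P_bc), rP_ac, rP_bc)`. [folklore] -/
def secRim (q r : ℝ) (P : S3) : S3 := ⟨r * P.s0 + (1 - r) * (q * P.s0 + P.sac + P.sbc), r * P.sac, r * P.sbc⟩

/-- The sector is closed under letters: `sec (z ∗ Z) = secConv z (sec Z)`. [folklore] -/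
theorem sec_conv (z Z : V5) : sec (conv z Z) = secConv z (sec Z) := by
  ext <;> simp [sec, secConv, conv]

/-- The sector is closed under rim steps. [folklore] -/
theorem sec_rimStep (q r : ℝ) (Z : V5) : sec (rimStep q r Z) = secRim q r (sec Z) := by
  ext <;> simp [sec, secRim, rimStep]

/-- `val` restricted to the partitions with `a ≁ b`: `q³Z_0 + q²(Z_ac + Z_bc)`. [folklore] -/
def valSep (q : ℝ) (Z : V5) : ℝ := q ^ 3 * Z.z0 + q ^ 2 * (Z.zac + Z.zbc)

/-- `val = valSep + (the a ~ b part)`. [folklore] -/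
theorem val_eq_valSep_add (q : ℝ) (Z : V5) : val q Z = valSep q Z + (q ^ 2 * Z.zab + q * Z.z1) := by
  simp only [val, valSep]; ring

/-- The sector gluing form: `valSep` of a product of two gadgets (pairs of sector partitions whose join keeps `a ≁ b`). [folklore] -/
def secG (q : ℝ) (P Q : S3) : ℝ :=
  q ^ 3 * (P.s0 * Q.s0) + q ^ 2 * (P.s0 * Q.sac + P.sac * Q.s0 + P.sac * Q.sac) + q ^ 2 * (P.s0 * Q.sbc + P.sbc * Q.s0 + P.sbc * Q.sbc)

/-- `valSep (X ∗ Y) = secG (sec X) (sec Y)`: the `a ≁ b` part of a glued partition function sees only the sectors. [folklore] -/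
theorem valSep_conv (q : ℝ) (X Y : V5) : valSep q (conv X Y) = secG q (sec X) (sec Y) := by
  simp only [valSep, conv, secG, sec]; ring

/-! ### Cross products and the cofactor maps -/

/-- The cross product of two sector triples (a dual triple). [folklore] -/
def scross (P Q : S3) : S3 :=
  ⟨P.sac * Q.sbc - P.sbc * Q.sac, P.sbc * Q.s0 - P.s0 * Q.sbc, P.s0 * Q.sac - P.sac * Q.s0⟩

/-- The dot product of triples. [folklore] -/
def sdot (P Q : S3) : ℝ := P.s0 * Q.s0 + P.sac * Q.sac + P.sbc * Q.sbc

/-- The cofactor map of the letter action: `cof(secConv z)`, `z = (z_0, ·, z_ac, z_bc, ·)`. [folklore] -/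
def cofConv (z : V5) (ω : S3) : S3 :=
  ⟨(z.z0 + z.zac) * (z.z0 + z.zbc) * ω.s0 - z.zac * (z.z0 + z.zbc) * ω.sac - z.zbc * (z.z0 + z.zac) * ω.sbc,
   z.z0 * (z.z0 + z.zbc) * ω.sac, z.z0 * (z.z0 + z.zac) * ω.sbc⟩

/-- The cofactor map of the rim step: `cof(secRim q r)`. [folklore] -/
def cofRim (q r : ℝ) (ω : S3) : S3 :=
  ⟨r * r * ω.s0, r * ((r + (1 - r) * q) * ω.sac - (1 - r) * ω.s0), r * ((r + (1 - r) * q) * ω.sbc - (1 - r) * ω.s0)⟩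

/-- `(zP) × (zQ) = cof(z)(P × Q)`. [folklore] -/
theorem scross_secConv (z : V5) (P Q : S3) : scross (secConv z P) (secConv z Q) = cofConv z (scross P Q) := by
  ext <;> simp only [scross, secConv, cofConv] <;> ring

/-- `(E P) × (E Q) = cof(E)(P × Q)`. [folklore] -/
theorem scross_secRim (q r : ℝ) (P Q : S3) : scross (secRim q r P) (secRim q r Q) = cofRim q r (scross P Q) := by
  ext <;> simp only [scross, secRim, cofRim] <;> ring

/-- The cofactor map of the gluing form: `cof(G)`, `G = q²·[[q,1,1],[1,1,0],[1,0,1]]`. [folklore] -/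
def cofG (q : ℝ) (ω : S3) : S3 :=
  ⟨q ^ 4 * (ω.s0 - ω.sac - ω.sbc), q ^ 4 * (-ω.s0 - (1 - q) * ω.sac + ω.sbc), q ^ 4 * (-ω.s0 + ω.sac - (1 - q) * ω.sbc)⟩

/-- **The `2 × 2` Gram determinant of the gluing form is a pairing of cross products**:
`G(P,R)G(Q,S) − G(P,S)G(Q,R) = ⟨P × Q, cof(G)(R × S)⟩`. [folklore] -/
theorem secG_det (q : ℝ) (P Q R S : S3) :
    secG q P R * secG q Q S - secG q P S * secG q Q R = sdot (scross P Q) (cofG q (scross R S)) := by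
  simp only [secG, sdot, scross, cofG]; ring

/-- `cofConv` is linear (scalars). [folklore] -/
theorem cofConv_smul (z : V5) (c : ℝ) (ω : S3) : cofConv z ⟨c * ω.s0, c * ω.sac, c * ω.sbc⟩ =
    ⟨c * (cofConv z ω).s0, c * (cofConv z ω).sac, c * (cofConv z ω).sbc⟩ := by
  ext <;> simp only [cofConv] <;> ring

/-- `cofRim` is linear (scalars). [folklore] -/
theorem cofRim_smul (q r c : ℝ) (ω : S3) : cofRim q r ⟨c * ω.s0, c * ω.sac, c * ω.sbc⟩ =
    ⟨c * (cofRim q r ω).s0, c * (cofRim q r ω).sac, c * (cofRim q r ω).sbc⟩ := by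
  ext <;> simp only [cofRim] <;> ring

/-! ### The invariant cone -/

/-- **The cone** `𝒞_p = {ω₁ ≥ 0, ω₂ ≤ 0, ω₃ ≤ 0, ω₁ − ω₃ + p ω₂ ≥ 0}` of dual triples (`p = 1 − q`). [folklore] -/
structure SecCone (p : ℝ) (ω : S3) : Prop where
  /-- `ω₁ ≥ 0` -/
  h1 : 0 ≤ ω.s0
  /-- `ω₂ ≤ 0` -/
  h2 : ω.sac ≤ 0
  /-- `ω₃ ≤ 0` -/
  h3 : ω.sbc ≤ 0
  /-- `ω₁ − ω₃ + p ω₂ ≥ 0` -/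
  h4 : 0 ≤ ω.s0 - ω.sbc + p * ω.sac

/-- The initial dual triple `v(u) = (u_bc, 0, −u_0)` lies in the cone. [folklore] -/
theorem secCone_init (p : ℝ) {u : V5} (hu : u.Nonneg) : SecCone p ⟨u.zbc, 0, -u.z0⟩ :=
  ⟨hu.hbc, le_rfl, by simpa using hu.h0, by have := hu.hbc; have := hu.h0; linarith⟩

/-- **The cone is invariant under the cofactor map of every letter with `z_0, z_ac, z_bc ≥ 0`** (`1 + p ≥ 0`). [folklore] -/
theorem SecCone.cofConv {p : ℝ} (hp : 0 ≤ 1 + p) {z : V5} (h0 : 0 ≤ z.z0) (hac : 0 ≤ z.zac) (hbc : 0 ≤ z.zbc) {ω : S3}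
    (h : SecCone p ω) : SecCone p (ThreeApex.cofConv z ω) := by
  obtain ⟨h1, h2, h3, h4⟩ := h
  have e2 : 0 ≤ -ω.sac := by linarith
  have e3 : 0 ≤ -ω.sbc := by linarith
  refine ⟨?_, ?_, ?_, ?_⟩
  · show 0 ≤ (z.z0 + z.zac) * (z.z0 + z.zbc) * ω.s0 - z.zac * (z.z0 + z.zbc) * ω.sac - z.zbc * (z.z0 + z.zac) * ω.sbc
    have := mul_nonneg (mul_nonneg hac (add_nonneg h0 hbc)) e2
    have := mul_nonneg (mul_nonneg hbc (add_nonneg h0 hac)) e3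
    have := mul_nonneg (mul_nonneg (add_nonneg h0 hac) (add_nonneg h0 hbc)) h1
    linarith
  · show z.z0 * (z.z0 + z.zbc) * ω.sac ≤ 0
    have := mul_nonneg (mul_nonneg h0 (add_nonneg h0 hbc)) e2
    linarith
  · show z.z0 * (z.z0 + z.zac) * ω.sbc ≤ 0
    have := mul_nonneg (mul_nonneg h0 (add_nonneg h0 hac)) e3
    linarith
  · -- `ω₁' − ω₃' + pω₂' = (z_0+z_ac)(z_0+z_bc)(ω₁−ω₃+pω₂) − (z_0+z_bc)(1+p) z_ac ω₂`
    have e : (z.z0 + z.zac) * (z.z0 + z.zbc) * ω.s0 - z.zac * (z.z0 + z.zbc) * ω.sac - z.zbc * (z.z0 + z.zac) * ω.sbc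
        - z.z0 * (z.z0 + z.zac) * ω.sbc + p * (z.z0 * (z.z0 + z.zbc) * ω.sac) =
        (z.z0 + z.zac) * (z.z0 + z.zbc) * (ω.s0 - ω.sbc + p * ω.sac) + (z.z0 + z.zbc) * (1 + p) * z.zac * (-ω.sac) := by ring
    show 0 ≤ (z.z0 + z.zac) * (z.z0 + z.zbc) * ω.s0 - z.zac * (z.z0 + z.zbc) * ω.sac - z.zbc * (z.z0 + z.zac) * ω.sbc
        - z.z0 * (z.z0 + z.zac) * ω.sbc + p * (z.z0 * (z.z0 + z.zbc) * ω.sac)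
    rw [e]
    have := mul_nonneg (mul_nonneg (add_nonneg h0 hac) (add_nonneg h0 hbc)) h4
    have := mul_nonneg (mul_nonneg (mul_nonneg (add_nonneg h0 hbc) hp) hac) e2
    linarith

/-- **The cone is invariant under the cofactor map of every rim step** (`0 ≤ q`, `0 ≤ r ≤ 1`, `p = 1 − q`):
the fourth facet is mapped by the exact factor `rρ`, `ρ = r + (1−r)q`. [folklore] -/
theorem SecCone.cofRim {q r : ℝ} (hq0 : 0 ≤ q) (hr0 : 0 ≤ r) (hr1 : r ≤ 1) {ω : S3}
    (h : SecCone (1 - q) ω) : SecCone (1 - q) (ThreeApex.cofRim q r ω) := by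
  obtain ⟨h1, h2, h3, h4⟩ := h
  have hr' : 0 ≤ 1 - r := sub_nonneg.2 hr1
  have hρ : 0 ≤ r + (1 - r) * q := by positivity
  have e2 : 0 ≤ -ω.sac := by linarith
  have e3 : 0 ≤ -ω.sbc := by linarith
  refine ⟨?_, ?_, ?_, ?_⟩
  · show 0 ≤ r * r * ω.s0
    positivity
  · show r * ((r + (1 - r) * q) * ω.sac - (1 - r) * ω.s0) ≤ 0
    have := mul_nonneg hρ e2
    have := mul_nonneg hr' h1
    have : (r + (1 - r) * q) * ω.sac - (1 - r) * ω.s0 ≤ 0 := by linarith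
    exact mul_nonpos_of_nonneg_of_nonpos hr0 this
  · show r * ((r + (1 - r) * q) * ω.sbc - (1 - r) * ω.s0) ≤ 0
    have := mul_nonneg hρ e3
    have := mul_nonneg hr' h1
    have : (r + (1 - r) * q) * ω.sbc - (1 - r) * ω.s0 ≤ 0 := by linarith
    exact mul_nonpos_of_nonneg_of_nonpos hr0 this
  · have e : r * r * ω.s0 - r * ((r + (1 - r) * q) * ω.sbc - (1 - r) * ω.s0) + (1 - q) * (r * ((r + (1 - r) * q) * ω.sac - (1 - r) * ω.s0))
        = r * (r + (1 - r) * q) * (ω.s0 - ω.sbc + (1 - q) * ω.sac) := by ring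
    show 0 ≤ r * r * ω.s0 - r * ((r + (1 - r) * q) * ω.sbc - (1 - r) * ω.s0) + (1 - q) * (r * ((r + (1 - r) * q) * ω.sac - (1 - r) * ω.s0))
    rw [e]
    exact mul_nonneg (mul_nonneg hr0 hρ) h4

/-- **The final pairing is non-negative on the cone**: `⟨(s_ac, −s_0, 0), cof(G) ω⟩ = q⁴(s_ac(ω₁−ω₂−ω₃) + s_0(ω₁−ω₃+pω₂)) ≥ 0`. [folklore] -/
theorem SecCone.pair_nonneg {q : ℝ} {ω : S3} (h : SecCone (1 - q) ω) {s0 sac : ℝ} (hs0 : 0 ≤ s0) (hsac : 0 ≤ sac) :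
    0 ≤ sdot ⟨sac, -s0, 0⟩ (cofG q ω) := by
  obtain ⟨h1, h2, h3, h4⟩ := h
  have e : sdot ⟨sac, -s0, 0⟩ (cofG q ω) = q ^ 4 * (sac * (ω.s0 - ω.sac - ω.sbc) + s0 * (ω.s0 - ω.sbc + (1 - q) * ω.sac)) := by
    simp only [sdot, cofG]; ring
  rw [e]
  have : 0 ≤ ω.s0 - ω.sac - ω.sbc := by linarith
  positivity

/-! ### Words: the blocks between the two spokes -/

/-- The middle blocks acting on the sector (mirror of `midWord`). [folklore] -/
def secMid (q : ℝ) : List (ℝ × ℝ × ℝ) → S3 → S3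
  | [], P => P
  | blk :: rest, P => secMid q rest (secConv (edgeAC blk.2.1) (secConv (edgeBC blk.2.2) (secRim q blk.1 P)))

/-- The cofactor maps of the middle blocks. [folklore] -/
def cofMid (q : ℝ) : List (ℝ × ℝ × ℝ) → S3 → S3
  | [], ω => ω
  | blk :: rest, ω => cofMid q rest (cofConv (edgeAC blk.2.1) (cofConv (edgeBC blk.2.2) (cofRim q blk.1 ω)))

/-- `sec ∘ midWord = secMid ∘ sec`. [folklore] -/
theorem sec_midWord (q : ℝ) : ∀ (mids : List (ℝ × ℝ × ℝ)) (X : V5), sec (midWord q mids X) = secMid q mids (sec X)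
  | [], _ => rfl
  | blk :: rest, X => by
    show sec (midWord q rest _) = secMid q rest _
    rw [sec_midWord q rest, sec_conv, sec_conv, sec_rimStep]

/-- Cross products through the middle blocks: `(W P) × (W Q) = cof(W)(P × Q)`. [folklore] -/
theorem scross_secMid (q : ℝ) : ∀ (mids : List (ℝ × ℝ × ℝ)) (P Q : S3),
    scross (secMid q mids P) (secMid q mids Q) = cofMid q mids (scross P Q)
  | [], _, _ => rfl
  | blk :: rest, P, Q => by
    show scross (secMid q rest _) (secMid q rest _) = cofMid q rest _
    rw [scross_secMid q rest, scross_secConv, scross_secConv, scross_secRim]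

/-- `cofMid` is linear (scalars). [folklore] -/
theorem cofMid_smul (q c : ℝ) : ∀ (mids : List (ℝ × ℝ × ℝ)) (ω : S3),
    cofMid q mids ⟨c * ω.s0, c * ω.sac, c * ω.sbc⟩ = ⟨c * (cofMid q mids ω).s0, c * (cofMid q mids ω).sac, c * (cofMid q mids ω).sbc⟩
  | [], _ => rfl
  | blk :: rest, ω => by
    show cofMid q rest _ = _
    rw [cofRim_smul, cofConv_smul, cofConv_smul, cofMid_smul q c rest]
    rfl

/-- **The cone survives every list of middle blocks with weights in `[0,1]`** (`0 ≤ q ≤ 2`). [folklore] -/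
theorem SecCone.cofMid {q : ℝ} (hq0 : 0 ≤ q) (hq2 : q ≤ 2) :
    ∀ {mids : List (ℝ × ℝ × ℝ)}, UnitBlocks mids → ∀ {ω : S3}, SecCone (1 - q) ω → SecCone (1 - q) (ThreeApex.cofMid q mids ω)
  | [], _, _, h => h
  | blk :: rest, hl, ω, h => by
    obtain ⟨hr0, hr1, hx0, hx1, hy0, hy1⟩ := hl blk List.mem_cons_self
    have hrest : UnitBlocks rest := fun b hb => hl b (List.mem_cons_of_mem _ hb)
    have hp : 0 ≤ 1 + (1 - q) := by linarith
    show SecCone (1 - q) (ThreeApex.cofMid q rest _)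
    refine SecCone.cofMid hq0 hq2 hrest ?_
    refine SecCone.cofConv hp (by simp only [edgeAC]; linarith) (by simp only [edgeAC]; exact hx0) (by simp [edgeAC]) ?_
    refine SecCone.cofConv hp (by simp only [edgeBC]; linarith) (by simp [edgeBC]) (by simp only [edgeBC]; exact hy0) ?_
    exact h.cofRim hq0 hr0 hr1

/-! ### The pinned partition functions restricted to `{a ↮ b}` and the theorem -/

/-- **The pinned partition functions of the cross-apex pair `(a c_j, b c_k)` restricted to `{a ↮ b}`**:
`C^{στ} = valSep_q((BC^τ ∗ s) ∗ E_{r_d} ∗ [blocks] ∗ (AC^σ ∗ u))`. [folklore] -/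
def crossSecZ (q : ℝ) (mids : List (ℝ × ℝ × ℝ)) (rd : ℝ) (u s : V5) (σ τ : ℝ) : ℝ :=
  valSep q (conv (conv (edgeBC τ) s) (rimStep q rd (midWord q mids (conv (edgeAC σ) u))))

/-- **The Rayleigh difference on `{a ↮ b}` as a pairing of cross products**:
`C¹⁰C⁰¹ − C¹¹C⁰⁰ = (u_0+u_ac)(s_0+s_bc)·⟨(s_ac, −s_0, 0), cof(G)·cof(E_{r_d})·cof(blocks)·(u_bc, 0, −u_0)⟩`. [folklore] -/
theorem rayleigh_crossSec_eq (q : ℝ) (mids : List (ℝ × ℝ × ℝ)) (rd : ℝ) (u s : V5) :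
    crossSecZ q mids rd u s 1 0 * crossSecZ q mids rd u s 0 1 - crossSecZ q mids rd u s 1 1 * crossSecZ q mids rd u s 0 0 =
      (u.z0 + u.zac) * (s.z0 + s.zbc) *
        sdot ⟨s.zac, -s.z0, 0⟩ (cofG q (cofRim q rd (cofMid q mids ⟨u.zbc, 0, -u.z0⟩))) := by
  simp only [crossSecZ, valSep_conv, sec_rimStep, sec_midWord, sec_conv]
  -- the two pinned sector vectors on each side
  have hu0 : secConv (edgeAC 0) (sec u) = sec u := by ext <;> simp [secConv, edgeAC, sec]
  have hs0 : secConv (edgeBC 0) (sec s) = sec s := by ext <;> simp [secConv, edgeBC, sec]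
  rw [hu0, hs0]
  set P0 := secRim q rd (secMid q mids (sec u)) with hP0
  set P1 := secRim q rd (secMid q mids (secConv (edgeAC 1) (sec u))) with hP1
  set R0 := sec s with hR0
  set R1 := secConv (edgeBC 1) (sec s) with hR1
  have h1 : secG q R0 P1 * secG q R1 P0 - secG q R1 P1 * secG q R0 P0 = -(sdot (scross R0 R1) (cofG q (scross P0 P1))) := by
    rw [← secG_det]; ring
  rw [h1, hP0, hP1, scross_secRim, scross_secMid]
  have hx : scross (sec u) (secConv (edgeAC 1) (sec u)) = ⟨(-(u.z0 + u.zac)) * u.zbc, (-(u.z0 + u.zac)) * 0, (-(u.z0 + u.zac)) * (-u.z0)⟩ := by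
    ext <;> simp [scross, secConv, edgeAC, sec] <;> ring
  have hx' : scross (sec u) (secConv (edgeAC 1) (sec u)) =
      ⟨(-(u.z0 + u.zac)) * (⟨u.zbc, 0, -u.z0⟩ : S3).s0, (-(u.z0 + u.zac)) * (⟨u.zbc, 0, -u.z0⟩ : S3).sac,
        (-(u.z0 + u.zac)) * (⟨u.zbc, 0, -u.z0⟩ : S3).sbc⟩ := by rw [hx]
  rw [hx', cofMid_smul, cofRim_smul]
  have hy : scross R0 R1 = ⟨(s.z0 + s.zbc) * s.zac, (s.z0 + s.zbc) * (-s.z0), 0⟩ := by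
    rw [hR0, hR1]; ext <;> simp [scross, secConv, edgeBC, sec] <;> ring
  rw [hy]
  simp only [sdot, cofG]
  ring

/-- **CONDITIONED ON `a ↮ b`, AN `a`-SPOKE AND A `b`-SPOKE AT ANY DISTANCE ARE NEGATIVELY CORRELATED** (algebra level):
`C¹⁰C⁰¹ − C¹¹C⁰⁰ ≥ 0` for all `0 ≤ q ≤ 2` (the cone argument does not use `q ≤ 1`), every list of middle blocks with weights in `[0,1]`,
every last rim weight `r_d ∈ [0,1]` and all rests `u, s` with non-negative masses. [folklore] -/
theorem rayleigh_crossSec_nonneg {q rd : ℝ} (hq0 : 0 ≤ q) (hq2 : q ≤ 2) {mids : List (ℝ × ℝ × ℝ)} (hmids : UnitBlocks mids)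
    (hrd0 : 0 ≤ rd) (hrd1 : rd ≤ 1) {u s : V5} (hu : u.Nonneg) (hs : s.Nonneg) :
    0 ≤ crossSecZ q mids rd u s 1 0 * crossSecZ q mids rd u s 0 1 - crossSecZ q mids rd u s 1 1 * crossSecZ q mids rd u s 0 0 := by
  rw [rayleigh_crossSec_eq]
  have hcone : SecCone (1 - q) (cofRim q rd (cofMid q mids ⟨u.zbc, 0, -u.z0⟩)) :=
    ((secCone_init (1 - q) hu).cofMid hq0 hq2 hmids).cofRim hq0 hrd0 hrd1
  have hY : 0 ≤ u.z0 + u.zac := add_nonneg hu.h0 hu.hac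
  have hZ : 0 ≤ s.z0 + s.zbc := add_nonneg hs.h0 hs.hbc
  exact mul_nonneg (mul_nonneg hY hZ) (hcone.pair_nonneg hs.h0 hs.hac)

/-- The same for rests in the rim-step closure `InKE q` (prefix / reversed suffix of a weighted double fan). [folklore] -/
theorem InKE.rayleigh_crossSec_nonneg {q rd : ℝ} (hq0 : 0 ≤ q) (hq1 : q ≤ 1) {mids : List (ℝ × ℝ × ℝ)} (hmids : UnitBlocks mids)
    (hrd0 : 0 ≤ rd) (hrd1 : rd ≤ 1) {u s : V5} (hu : InKE q u) (hs : InKE q s) :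
    0 ≤ crossSecZ q mids rd u s 1 0 * crossSecZ q mids rd u s 0 1 - crossSecZ q mids rd u s 1 1 * crossSecZ q mids rd u s 0 0 :=
  ThreeApex.rayleigh_crossSec_nonneg hq0 (by linarith) hmids hrd0 hrd1 (hu.valid hq0 hq1).nonneg (hs.valid hq0 hq1).nonneg

end ThreeApex

end FK

end Summit.CriticalPhenomena.PercolationContinuityZ3.Theorems
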